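import Literature.NumberTheory.QuadraticForms.HermitianUnimodularLocalRing
import Literature.NumberTheory.LocalFields.UnramifiedQuadraticNormSurjective
import Literature.NumberTheory.Automorphic.UnitaryGroupIntegralPointsReductionInert
import Literature.NumberTheory.Automorphic.UnitaryGroupInertPlaceHyperbolicBasis
import Literature.LinearAlgebra.Matrix.FiniteFieldHermitianAnisotropic
import HarnessLib

/-!
# The self-dual locus of `GL_n(E_w)` is `U(J)(E_w) · GL_n(𝒪_w)`: the unitary group of a unimodular hermitian form is
# transitive on self-dual lattices (Jacobowitz 1962, Thm. 7.1; Kottwitz 1992, Lemma 7.2 ∕ Cor. 7.3, Case A)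

Topic `NumberTheory/Automorphic`; namespace `Literature.NumberTheory.Automorphic.UnitaryGroup`.  KERNEL ONLY: theorems, no
definition, no instance, no notation, no named fact, no `sorry`.  Cell `hodgecm-mathlib`, brick (D4) «N7-inert-L1» of the inert unit
fundamental-lemma road (the dictionary `U(J)(E_w) ∕ K ≅ {self-dual 𝒪_w-lattices}`, `K = U(J)(𝒪_w)` hyperspecial), in MATRIX currency:
`glInt n E` (★ `ReductiveGroupData`), `unitaryGroupOfForm σ J` (★ `UnitaryGroupAutomorphicRep`), `formCongr σ T H = (σT)ᵀ H T`
(★ `UnitaryGroupFormTransport`).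

**Dictionary.**  For `g ∈ GL_n(E)` the lattice `Λ = g 𝒪ⁿ ⊂ Eⁿ` has Gram matrix `formCongr σ g J = (σg)ᵀ J g` in the basis given by the columns
of `g`; `Λ` is SELF-DUAL for the hermitian form `J` iff that Gram matrix is unimodular, i.e. lies in `GL_n(𝒪) = glInt n E` (integral with
integral inverse; ★ `SelfDualHermitianLatticesUpToScalar` §1 is the coordinate-free form of this remark).  Two lattices `g 𝒪ⁿ`, `g' 𝒪ⁿ`
coincide iff `g⁻¹ g' ∈ GL_n(𝒪)`.  Hence «`U(J)(E)` acts transitively on the self-dual lattices» is the statement proved here: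

* `exists_mem_unitaryGroupOfForm_mul_of_selfDual` — if `J ∈ GL_n(𝒪)` is `σ`-hermitian and `formCongr σ g J ∈ GL_n(𝒪)`, then
  `g = u * k` with `u ∈ U(J)` and `k ∈ GL_n(𝒪)` (hypothesis-driven: `𝒪 = 𝒪[E]` any valuation ring with an involution `σ` satisfying
  Jacobowitz's (trace) `b + σ b = 1` and (norm) «`σ`-fixed units are norms»);
* `exists_mem_unitaryGroupOfForm_mul_iff` — conversely every `u k` has unimodular Gram matrix: the self-dual locus IS `U(J)·GL_n(𝒪)`;
  `inv_mul_mem_inf_of_mul_eq_mul` — the fibres of `(u, k) ↦ u k` are the `K`-cosets, `K = U(J) ⊓ GL_n(𝒪)`;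
* `…_of_isUnit_sub`, `…_of_frobenius` — over a non-archimedean LOCAL field (trace) and (norm) are theorems as soon as `σ` is residually
  non-trivial (★ `UnramifiedQuadraticNorm.exists_formCongr_eq_of_finite_residueField`, [Serre1979, V §2 Prop. 3]); the `_of_frobenius` form
  carries the binders of ★ `unitary_residueHom_surjective_of_frobenius` (`|𝓀| = q²`, `σ̄ = Frob_q`);
* `…_of_nonsplit` — the same at a finite place `w ∣ v` of a quadratic extension of number fields `E ∕ F` that is NON-SPLIT (`c • w = w`) and
  UNRAMIFIED, for the local Galois involution `σ_w = galAdicCompletionMap c hw`, at EVERY residue characteristic (★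
  `residueHom_galAdicCompletionMap_eq_pow`, ★ `fintypeCard_residueField_eq_sq_of_inert`, ★ `exists_frob_ne`).

The engine is the tree's Jacobowitz theorem ★ `HermitianUnimodular.exists_formCongr_eq` (any two unimodular `σ`-hermitian matrices over such
a local ring are `GL_n(𝒪)`-congruent): with `J' := formCongr σ g J` it yields `T ∈ GL_n(𝒪)` with `formCongr σ T J = J'`, and then
`u := g T⁻¹ ∈ U(J)`, `k := T`.

References: [Jacobowitz1962] R. Jacobowitz, *Hermitian forms over local fields*, Amer. J. Math. 84 (1962), §7 Thm. 7.1;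
[Kottwitz1992] R. E. Kottwitz, *Points on some Shimura varieties over finite fields*, JAMS 5 (1992), Lemma 7.2, Cor. 7.3;
[Serre1979] J.-P. Serre, *Local Fields*, Ch. V §2 Prop. 3.  HC_CM is proved only modulo the 7 printed citations until rung 0 closes;
this file is a rung-0 structural input (row D-N7ns, L1), not a binder.
-/

set_option autoImplicit false

open NumberField IsDedekindDomain
open scoped Matrix ValuativeRel

namespace Literature.NumberTheory.Automorphic.UnitaryGroup

open Literature.NumberTheory.Automorphic Literature.NumberTheory.QuadraticForms Literature.NumberTheory.LocalFields

/-! ## §0 Congruence bookkeeping over a commutative ring -/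

section Bookkeeping

variable {R : Type*} [CommRing R] {ι : Type*} [Fintype ι] [DecidableEq ι] (σ : R →+* R)

/-- congruence is a right action: `formCongr σ (S T) H = formCongr σ T (formCongr σ S H)` (change of basis of a Gram matrix,
[Omeara1963, §82A]). [cite: Omeara1963, §82A] -/
theorem formCongr_mul_eq_formCongr_formCongr (S T : GL ι R) (H : Matrix ι ι R) :
    formCongr σ (S * T) H = formCongr σ T (formCongr σ S H) := by
  simp only [formCongr, Units.val_mul, Matrix.map_mul, Matrix.transpose_mul, Matrix.mul_assoc]

/-- congruence preserves `σ`-hermitian matrices when `σ` is an involution (the Gram matrix of a hermitian form in any basis is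
hermitian, [Jacobowitz1962, §4]). [cite: Jacobowitz1962, §4] -/
theorem formCongr_hermitian (hσσ : ∀ x, σ (σ x) = x) (T : GL ι R) {H : Matrix ι ι R} (hH : (H.map σ)ᵀ = H) :
    ((formCongr σ T H).map σ)ᵀ = formCongr σ T H := by
  have hTT : ((T : Matrix ι ι R).map σ).map σ = T := by
    rw [Matrix.map_map]
    conv_rhs => rw [← Matrix.map_id (T : Matrix ι ι R)]
    congr 1
    funext x
    exact hσσ x
  have hHt : (H.map σ) = Hᵀ := by
    conv_rhs => rw [← hH]
    rw [Matrix.transpose_transpose]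
  simp only [formCongr, Matrix.map_mul, Matrix.transpose_mul, Matrix.transpose_map, hTT, hHt, Matrix.transpose_transpose,
    Matrix.mul_assoc]

end Bookkeeping

/-! ## §1 Generic layer: a valued field `E` with an involution `σ` preserving `𝒪[E]` -/

section Generic

variable {E : Type*} [Field E] [ValuativeRel E] (σ : E →+* E) {n : ℕ}

/-- **`GL_n(𝒪)` preserves the self-dual locus**: for `J, k ∈ GL_n(𝒪)` the Gram matrix `(σk)ᵀ J k` again lies in `GL_n(𝒪)`
(`σ` preserving `𝒪`) — a change of `𝒪`-basis preserves unimodularity of the Gram matrix [Omeara1963, 82:13].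
[cite: Omeara1963, §82:13] -/
theorem exists_mem_glInt_coe_eq_formCongr (hσO : ∀ x : 𝒪[E], σ x ∈ 𝒪[E])
    (J : GL (Fin n) E) (hJ : J ∈ glInt n E) (k : GL (Fin n) E) (hk : k ∈ glInt n E) :
    ∃ J' ∈ glInt n E, (J' : Matrix (Fin n) (Fin n) E) = formCongr σ k (J : Matrix (Fin n) (Fin n) E) := by
  classical
  obtain ⟨J₀, rfl⟩ := hJ
  obtain ⟨k₀, rfl⟩ := hk
  let τ : 𝒪[E] →+* 𝒪[E] := (σ.comp (𝒪[E]).subtype).codRestrict (𝒪[E]) fun x => hσO x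
  have hcomp : ⇑(𝒪[E]).subtype ∘ ⇑τ = ⇑σ ∘ ⇑(𝒪[E]).subtype := funext fun _ => rfl
  -- the integral Gram matrix has unit determinant
  have hk₀ : IsUnit ((k₀ : Matrix (Fin n) (Fin n) 𝒪[E]).map τ).det :=
    Matrix.isUnits_det_units (Matrix.GeneralLinearGroup.map τ k₀)
  have hdet : IsUnit (formCongr τ k₀ (J₀ : Matrix (Fin n) (Fin n) 𝒪[E])).det := by
    rw [formCongr, Matrix.det_mul, Matrix.det_mul]
    exact ((Matrix.isUnit_det_transpose _ hk₀).mul (Matrix.isUnits_det_units J₀)).mul (Matrix.isUnits_det_units k₀)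
  refine ⟨Matrix.GeneralLinearGroup.map (𝒪[E]).subtype (Matrix.GeneralLinearGroup.mk'' _ hdet), ⟨_, rfl⟩, ?_⟩
  change (formCongr τ k₀ (J₀ : Matrix (Fin n) (Fin n) 𝒪[E])).map (𝒪[E]).subtype =
    formCongr σ (Matrix.GeneralLinearGroup.map (𝒪[E]).subtype k₀) (((J₀ : Matrix (Fin n) (Fin n) 𝒪[E])).map (𝒪[E]).subtype)
  simp only [formCongr, Matrix.map_mul, Matrix.transpose_map, Matrix.map_map, hcomp]
  rfl

/-- **Group algebra of the decomposition**: if some `T ∈ GL_n(𝒪)` has the same Gram matrix as `g`, `(σT)ᵀ J T = (σg)ᵀ J g`, then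
`g = u k` with `u := g T⁻¹ ∈ U(J)` and `k := T ∈ GL_n(𝒪)` (the deduction of [Kottwitz1992, Cor. 7.3] from Lemma 7.2).
[cite: Kottwitz1992, §7 Cor. 7.3] -/
theorem exists_mem_unitaryGroupOfForm_mul_of_formCongr_eq (J g T : GL (Fin n) E) (hT : T ∈ glInt n E)
    (h : formCongr σ T (J : Matrix (Fin n) (Fin n) E) = formCongr σ g (J : Matrix (Fin n) (Fin n) E)) :
    ∃ u ∈ unitaryGroupOfForm σ (J : Matrix (Fin n) (Fin n) E), ∃ k ∈ glInt n E, g = u * k := by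
  refine ⟨g * T⁻¹, ?_, T, hT, (inv_mul_cancel_right g T).symm⟩
  rw [mem_unitaryGroupOfForm_iff]
  change formCongr σ (g * T⁻¹) (J : Matrix (Fin n) (Fin n) E) = J
  rw [formCongr_mul_eq_formCongr_formCongr, ← h, formCongr_inv_formCongr]

/-- The common plumbing: a congruence theorem for unimodular `τ`-hermitian matrices over `𝒪[E]` (`τ = σ|𝒪`) yields the
decomposition `g = u k` of every `g` with unimodular Gram matrix. [cite: Jacobowitz1962, §7 Thm. 7.1] -/
private theorem exists_mem_unitaryGroupOfForm_mul_of_congr (hσσ : ∀ x, σ (σ x) = x) (hσO : ∀ x : 𝒪[E], σ x ∈ 𝒪[E])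
    (hjac : ∀ H H' : Matrix (Fin n) (Fin n) 𝒪[E],
      (H.map ((σ.comp (𝒪[E]).subtype).codRestrict (𝒪[E]) fun x => hσO x))ᵀ = H → IsUnit H.det →
      (H'.map ((σ.comp (𝒪[E]).subtype).codRestrict (𝒪[E]) fun x => hσO x))ᵀ = H' → IsUnit H'.det →
      ∃ T : GL (Fin n) 𝒪[E], formCongr ((σ.comp (𝒪[E]).subtype).codRestrict (𝒪[E]) fun x => hσO x) T H' = H)
    (J : GL (Fin n) E) (hJ : J ∈ glInt n E) (hJh : ((J : Matrix (Fin n) (Fin n) E).map σ)ᵀ = J)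
    (g : GL (Fin n) E) (hg : ∃ J' ∈ glInt n E, (J' : Matrix (Fin n) (Fin n) E) = formCongr σ g (J : Matrix (Fin n) (Fin n) E)) :
    ∃ u ∈ unitaryGroupOfForm σ (J : Matrix (Fin n) (Fin n) E), ∃ k ∈ glInt n E, g = u * k := by
  classical
  obtain ⟨J', hJ', hgJ⟩ := hg
  obtain ⟨J₀, rfl⟩ := hJ
  obtain ⟨J₀', rfl⟩ := hJ'
  set τ : 𝒪[E] →+* 𝒪[E] := (σ.comp (𝒪[E]).subtype).codRestrict (𝒪[E]) fun x => hσO x with hτdef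
  have hcomp : ⇑(𝒪[E]).subtype ∘ ⇑τ = ⇑σ ∘ ⇑(𝒪[E]).subtype := funext fun _ => rfl
  have hinj : Function.Injective (fun M : Matrix (Fin n) (Fin n) 𝒪[E] => M.map (𝒪[E]).subtype) :=
    Matrix.map_injective Subtype.val_injective
  have hcoe : ∀ M₀ : GL (Fin n) 𝒪[E], ((Matrix.GeneralLinearGroup.map (𝒪[E]).subtype M₀ : GL (Fin n) E) : Matrix (Fin n) (Fin n) E) =
      (M₀ : Matrix (Fin n) (Fin n) 𝒪[E]).map (𝒪[E]).subtype := fun _ => rfl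
  -- hermitian-ness over `𝒪` is inherited from `E` (injectivity of `𝒪 ↪ E`)
  have hherm : ∀ M₀ : GL (Fin n) 𝒪[E],
      ((((Matrix.GeneralLinearGroup.map (𝒪[E]).subtype M₀ : GL (Fin n) E) : Matrix (Fin n) (Fin n) E)).map σ)ᵀ =
        (Matrix.GeneralLinearGroup.map (𝒪[E]).subtype M₀ : GL (Fin n) E) →
      ((M₀ : Matrix (Fin n) (Fin n) 𝒪[E]).map τ)ᵀ = M₀ := by
    intro M₀ hM₀
    apply hinj
    change (((M₀ : Matrix (Fin n) (Fin n) 𝒪[E]).map τ)ᵀ).map _ = (M₀ : Matrix (Fin n) (Fin n) 𝒪[E]).map _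
    rw [Matrix.transpose_map, Matrix.map_map, hcomp, ← Matrix.map_map, ← hcoe]
    exact hM₀
  have hJ₀h : ((J₀ : Matrix (Fin n) (Fin n) 𝒪[E]).map τ)ᵀ = J₀ := hherm J₀ hJh
  have hJ₀'h : ((J₀' : Matrix (Fin n) (Fin n) 𝒪[E]).map τ)ᵀ = J₀' := by
    refine hherm J₀' ?_
    rw [hgJ]
    exact formCongr_hermitian σ hσσ g hJh
  -- Jacobowitz over `𝒪`: `(τT₀)ᵀ J₀ T₀ = J₀'`
  obtain ⟨T₀, hT₀⟩ := hjac (J₀' : Matrix (Fin n) (Fin n) 𝒪[E]) (J₀ : Matrix (Fin n) (Fin n) 𝒪[E])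
    hJ₀'h (Matrix.isUnits_det_units J₀') hJ₀h (Matrix.isUnits_det_units J₀)
  -- push the congruence forward along `𝒪 ↪ E`
  refine exists_mem_unitaryGroupOfForm_mul_of_formCongr_eq σ _ g (Matrix.GeneralLinearGroup.map (𝒪[E]).subtype T₀) ⟨T₀, rfl⟩ ?_
  rw [← hgJ, hcoe J₀', ← hT₀, hcoe J₀]
  simp only [formCongr, Matrix.map_mul, Matrix.transpose_map, Matrix.map_map, hcomp]
  rfl

/-- **`U(J)(E)` is transitive on self-dual lattices — the self-dual locus of `GL_n(E)` is `U(J)·GL_n(𝒪)`** (hypothesis-driven form).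
`E` a valued field, `σ` an involution of `E` preserving `𝒪 = 𝒪[E]` with (trace) `b + σ b = 1` soluble in `𝒪` and (norm) every `σ`-fixed
unit of `𝒪` a norm `t σ(t)` (the valuation ring of an unramified quadratic extension of non-archimedean local fields); `J ∈ GL_n(𝒪)`
`σ`-hermitian.  If the Gram matrix `(σg)ᵀ J g` of `g ∈ GL_n(E)` lies in `GL_n(𝒪)` (the lattice `g𝒪ⁿ` is self-dual), then `g = u k` with
`u ∈ U(J)(E)` and `k ∈ GL_n(𝒪)`. [cite: Jacobowitz1962, §7 Thm. 7.1] [cite: Kottwitz1992, §7 Lemma 7.2, Cor. 7.3] -/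
theorem exists_mem_unitaryGroupOfForm_mul_of_selfDual (hσσ : ∀ x, σ (σ x) = x) (hσO : ∀ x : 𝒪[E], σ x ∈ 𝒪[E])
    (htr : ∃ b : 𝒪[E], (b : E) + σ b = 1)
    (hnorm : ∀ u : 𝒪[E], IsUnit u → σ u = u → ∃ t : 𝒪[E], (t : E) * σ t = u)
    (J : GL (Fin n) E) (hJ : J ∈ glInt n E) (hJh : ((J : Matrix (Fin n) (Fin n) E).map σ)ᵀ = J)
    (g : GL (Fin n) E) (hg : ∃ J' ∈ glInt n E, (J' : Matrix (Fin n) (Fin n) E) = formCongr σ g (J : Matrix (Fin n) (Fin n) E)) :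
    ∃ u ∈ unitaryGroupOfForm σ (J : Matrix (Fin n) (Fin n) E), ∃ k ∈ glInt n E, g = u * k := by
  classical
  set τ : 𝒪[E] →+* 𝒪[E] := (σ.comp (𝒪[E]).subtype).codRestrict (𝒪[E]) fun x => hσO x with hτdef
  have hτ : ∀ x, τ (τ x) = x := fun x => Subtype.ext (hσσ x)
  have htr' : ∃ b : 𝒪[E], b + τ b = 1 := by
    obtain ⟨b, hb⟩ := htr
    exact ⟨b, Subtype.ext hb⟩
  have hnorm' : ∀ u : 𝒪[E], IsUnit u → τ u = u → ∃ t : 𝒪[E], t * τ t = u := by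
    intro u hu hτu
    obtain ⟨t, ht⟩ := hnorm u hu (congrArg Subtype.val hτu)
    exact ⟨t, Subtype.ext ht⟩
  exact exists_mem_unitaryGroupOfForm_mul_of_congr σ hσσ hσO
    (fun H H' hH hd hH' hd' => HermitianUnimodular.exists_formCongr_eq τ hτ htr' hnorm' H H' hH hd hH' hd') J hJ hJh g hg

/-- **The dictionary `U(J)(E) ∕ K ≅ {self-dual lattices}`**: under the hypotheses of `exists_mem_unitaryGroupOfForm_mul_of_selfDual`,
`g ∈ GL_n(E)` factors as `u k` (`u ∈ U(J)`, `k ∈ GL_n(𝒪)`) IFF its Gram matrix `(σg)ᵀ J g` lies in `GL_n(𝒪)` (the lattice `g𝒪ⁿ` is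
self-dual). [cite: Jacobowitz1962, §7 Thm. 7.1] [cite: Kottwitz1992, §7 Lemma 7.2, Cor. 7.3] -/
theorem exists_mem_unitaryGroupOfForm_mul_iff (hσσ : ∀ x, σ (σ x) = x) (hσO : ∀ x : 𝒪[E], σ x ∈ 𝒪[E])
    (htr : ∃ b : 𝒪[E], (b : E) + σ b = 1)
    (hnorm : ∀ u : 𝒪[E], IsUnit u → σ u = u → ∃ t : 𝒪[E], (t : E) * σ t = u)
    (J : GL (Fin n) E) (hJ : J ∈ glInt n E) (hJh : ((J : Matrix (Fin n) (Fin n) E).map σ)ᵀ = J) (g : GL (Fin n) E) :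
    (∃ u ∈ unitaryGroupOfForm σ (J : Matrix (Fin n) (Fin n) E), ∃ k ∈ glInt n E, g = u * k) ↔
      ∃ J' ∈ glInt n E, (J' : Matrix (Fin n) (Fin n) E) = formCongr σ g (J : Matrix (Fin n) (Fin n) E) := by
  refine ⟨?_, exists_mem_unitaryGroupOfForm_mul_of_selfDual σ hσσ hσO htr hnorm J hJ hJh g⟩
  rintro ⟨u, hu, k, hk, rfl⟩
  obtain ⟨J', hJ', hJ'k⟩ := exists_mem_glInt_coe_eq_formCongr σ hσO J hJ k hk
  refine ⟨J', hJ', ?_⟩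
  rw [hJ'k, formCongr_mul_eq_formCongr_formCongr, show formCongr σ u (J : Matrix (Fin n) (Fin n) E) = J from
    mem_unitaryGroupOfForm_iff.1 hu]

/-- **Fibres**: `u k = u' k'` with `u, u' ∈ U(J)` and `k, k' ∈ GL_n(𝒪)` forces `u⁻¹ u' ∈ K := U(J) ⊓ GL_n(𝒪)` — the map
`u ↦ u 𝒪ⁿ` from `U(J) ∕ K` to the self-dual lattices is injective (the stabiliser of the standard lattice in `U(J)` is
`K = U(J)(𝒪)`, [Kottwitz1992, §7, p. 397]). [cite: Kottwitz1992, §7 Cor. 7.3] -/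
theorem inv_mul_mem_inf_of_mul_eq_mul {J : Matrix (Fin n) (Fin n) E} {u u' k k' : GL (Fin n) E}
    (hu : u ∈ unitaryGroupOfForm σ J) (hu' : u' ∈ unitaryGroupOfForm σ J) (hk : k ∈ glInt n E) (hk' : k' ∈ glInt n E)
    (h : u * k = u' * k') : u⁻¹ * u' ∈ unitaryGroupOfForm σ J ⊓ glInt n E := by
  refine Subgroup.mem_inf.2 ⟨mul_mem (inv_mem hu) hu', ?_⟩
  have hkk : u⁻¹ * u' = k * k'⁻¹ := by
    rw [inv_mul_eq_iff_eq_mul, ← mul_assoc, eq_mul_inv_iff_mul_eq]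
    exact h.symm
  rw [hkk]
  exact mul_mem hk (inv_mem hk')

end Generic

/-! ## §2 Over a non-archimedean local field: (trace) and (norm) discharged -/

section LocalField

variable {E : Type*} [Field E] [ValuativeRel E] [UniformSpace E] [IsUniformAddGroup E] [IsNonarchimedeanLocalField E]
  (σ : E →+* E) {n : ℕ}

/-- **`U(J)(E)` is transitive on self-dual lattices, `E` a non-archimedean local field, `σ` residually non-trivial.**  `σ` an
involution of `E` preserving `𝒪` such that `σ a − a` is a UNIT for some `a ∈ 𝒪` (the conjugation of an unramified quadratic extension
`E ∕ F`); `J ∈ GL_n(𝒪)` `σ`-hermitian; then every `g` whose Gram matrix `(σg)ᵀ J g` lies in `GL_n(𝒪)` is `u k`, `u ∈ U(J)`, `k ∈ GL_n(𝒪)`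
((trace) and (norm) hold by [Serre1979, V §2 Prop. 3] — ★ `UnramifiedQuadraticNorm.exists_formCongr_eq_of_finite_residueField`).
[cite: Jacobowitz1962, §7 Thm. 7.1] [cite: Serre1979, Ch. V §2 Prop. 3] -/
theorem exists_mem_unitaryGroupOfForm_mul_of_selfDual_of_isUnit_sub (hσσ : ∀ x, σ (σ x) = x)
    (hσO : ∀ x : 𝒪[E], σ x ∈ 𝒪[E]) (a : 𝒪[E]) (ha : IsUnit ((⟨σ a, hσO a⟩ : 𝒪[E]) - a))
    (J : GL (Fin n) E) (hJ : J ∈ glInt n E) (hJh : ((J : Matrix (Fin n) (Fin n) E).map σ)ᵀ = J)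
    (g : GL (Fin n) E) (hg : ∃ J' ∈ glInt n E, (J' : Matrix (Fin n) (Fin n) E) = formCongr σ g (J : Matrix (Fin n) (Fin n) E)) :
    ∃ u ∈ unitaryGroupOfForm σ (J : Matrix (Fin n) (Fin n) E), ∃ k ∈ glInt n E, g = u * k := by
  classical
  set τ : 𝒪[E] →+* 𝒪[E] := (σ.comp (𝒪[E]).subtype).codRestrict (𝒪[E]) fun x => hσO x with hτdef
  have hτ : ∀ x, τ (τ x) = x := fun x => Subtype.ext (hσσ x)
  have ha' : IsUnit (τ a - a) := ha
  exact exists_mem_unitaryGroupOfForm_mul_of_congr σ hσσ hσO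
    (fun H H' hH hd hH' hd' => UnramifiedQuadraticNorm.exists_formCongr_eq_of_finite_residueField τ hτ ha' H H' hH hd hH' hd')
    J hJ hJh g hg

/-- **Inert reading** — binders of ★ `unitary_residueHom_surjective_of_frobenius`: `𝓀[E]` of order `q²` and the reduction `σ̄` of `σ`
equal to the `q`-Frobenius (so `σ̄ ≠ id`: ★ `exists_frob_ne`); then the self-dual locus of `GL_n(E)` is `U(J)·GL_n(𝒪)` for every
unimodular `σ`-hermitian `J`. [cite: Jacobowitz1962, §7 Thm. 7.1] [cite: Serre1979, Ch. V §2 Prop. 3] -/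
theorem exists_mem_unitaryGroupOfForm_mul_of_selfDual_of_frobenius (hσσ : ∀ x, σ (σ x) = x)
    (hσO : ∀ x : 𝒪[E], σ x ∈ 𝒪[E]) (σk : 𝓀[E] →+* 𝓀[E])
    (hσk : ∀ x : 𝒪[E], IsLocalRing.residue 𝒪[E] ⟨σ x, hσO x⟩ = σk (IsLocalRing.residue 𝒪[E] x))
    [Fintype 𝓀[E]] {q : ℕ} (hk : Fintype.card 𝓀[E] = q ^ 2) (hfrob : ∀ y, σk y = y ^ q)
    (J : GL (Fin n) E) (hJ : J ∈ glInt n E) (hJh : ((J : Matrix (Fin n) (Fin n) E).map σ)ᵀ = J)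
    (g : GL (Fin n) E) (hg : ∃ J' ∈ glInt n E, (J' : Matrix (Fin n) (Fin n) E) = formCongr σ g (J : Matrix (Fin n) (Fin n) E)) :
    ∃ u ∈ unitaryGroupOfForm σ (J : Matrix (Fin n) (Fin n) E), ∃ k ∈ glInt n E, g = u * k := by
  obtain ⟨y, hy⟩ := Literature.LinearAlgebra.Matrix.exists_frob_ne hk σk hfrob
  obtain ⟨a, rfl⟩ := IsLocalRing.residue_surjective y
  refine exists_mem_unitaryGroupOfForm_mul_of_selfDual_of_isUnit_sub σ hσσ hσO a ?_ J hJ hJh g hg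
  by_contra hna
  apply hy
  have hmem : (⟨σ a, hσO a⟩ : 𝒪[E]) - a ∈ IsLocalRing.maximalIdeal 𝒪[E] :=
    (IsLocalRing.mem_maximalIdeal _).2 (mem_nonunits_iff.2 hna)
  rw [← hσk, ← sub_eq_zero, ← map_sub, IsLocalRing.residue_eq_zero_iff]
  exact hmem

end LocalField

/-! ## §3 At a non-split unramified place of a quadratic extension of number fields -/

section NumberField

variable {F E : Type} [Field F] [NumberField F] [Field E] [NumberField E] [Algebra F E]
  [Algebra.IsQuadraticExtension F E] (c : E ≃ₐ[F] E) {v : HeightOneSpectrum (𝓞 F)} (w : PlacesOver E v)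

/-- **`U(J)(E_w)` is transitive on self-dual `𝒪_w`-lattices at an INERT place** (`v` unramified in `E`, `w ∣ v` with `c • w = w`, `c ≠ 1`,
ANY residue characteristic), for the local Galois involution `σ_w = galAdicCompletionMap c hw` and a `σ_w`-hermitian `J ∈ GL_N(𝒪_w)`:
every `g ∈ GL_N(E_w)` with `(σ_w g)ᵀ J g ∈ GL_N(𝒪_w)` is `u k`, `u ∈ U(J)(E_w)`, `k ∈ GL_N(𝒪_w)`.  Consumers holding the global datum
`hJw : IsUnit (placeForm J w)`, `hJw.unit ∈ glInt` pass `J := hJw.unit`.  (`σ̄_w = Frob_{q_v}` by ★ `residueHom_galAdicCompletionMap_eq_pow`,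
`|𝓀_w| = q_v²` by ★ `fintypeCard_residueField_eq_sq_of_inert`.) [cite: Jacobowitz1962, §7 Thm. 7.1] [cite: Kottwitz1992, §7 Cor. 7.3] -/
theorem exists_mem_unitaryGroupOfForm_mul_of_selfDual_of_nonsplit (hc1 : c ≠ 1) (hw : c • w.1 = w.1)
    (hv : Algebra.IsUnramifiedIn (𝓞 E) v.asIdeal) {N : ℕ}
    (J : GL (Fin N) (w.1.adicCompletion E)) (hJ : J ∈ glInt N (w.1.adicCompletion E))
    (hJh : ((J : Matrix (Fin N) (Fin N) (w.1.adicCompletion E)).map (galAdicCompletionMap (L := E) c hw))ᵀ = J)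
    (g : GL (Fin N) (w.1.adicCompletion E))
    (hg : ∃ J' ∈ glInt N (w.1.adicCompletion E), (J' : Matrix (Fin N) (Fin N) (w.1.adicCompletion E)) =
      formCongr (galAdicCompletionMap (L := E) c hw) g (J : Matrix (Fin N) (Fin N) (w.1.adicCompletion E))) :
    ∃ u ∈ unitaryGroupOfForm (galAdicCompletionMap (L := E) c hw) (J : Matrix (Fin N) (Fin N) (w.1.adicCompletion E)),
      ∃ k ∈ glInt N (w.1.adicCompletion E), g = u * k := by
  classical
  letI : Fintype 𝓀[w.1.adicCompletion E] := Fintype.ofFinite _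
  have hσσ : ∀ x, galAdicCompletionMap (L := E) c hw (galAdicCompletionMap (L := E) c hw x) = x :=
    galAdicCompletionMap_galAdicCompletionMap_of_smul_eq c w hc1 hw
  have hσO : ∀ x : 𝒪[w.1.adicCompletion E], galAdicCompletionMap (L := E) c hw x ∈ 𝒪[w.1.adicCompletion E] :=
    fun x => mem_integer_galAdicCompletionMap c v w hw x
  obtain ⟨σk, hσk⟩ := exists_residueField_ringHom_galAdicCompletionMap c v w hw
  have hk : Fintype.card 𝓀[w.1.adicCompletion E] = Nat.card (𝓞 F ⧸ v.asIdeal) ^ 2 :=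
    fintypeCard_residueField_eq_sq_of_inert c v hc1 hv w hw
  have hfrob : ∀ y, σk y = y ^ Nat.card (𝓞 F ⧸ v.asIdeal) :=
    residueHom_galAdicCompletionMap_eq_pow c v hc1 hv w hw σk hσO hσk
  exact exists_mem_unitaryGroupOfForm_mul_of_selfDual_of_frobenius (galAdicCompletionMap (L := E) c hw) hσσ hσO σk hσk
    hk hfrob J hJ hJh g hg

end NumberField

end Literature.NumberTheory.Automorphic.UnitaryGroup
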